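import Mathlib
import HarnessLib

/-!
# The `−2π · f(a)` collapse: Fubini and the fundamental theorem of calculus along the rays `τ ↦ a + τ(V + W θ)` on the half-strip
# `τ > 0`, `θ ∈ (0, 2π]` (the last step of Harish-Chandra's rank-one limit formula; Varadarajan 1989, §6.4 Lemma 21 (b) ∕ Thm 22)

Topic `NumberTheory/Automorphic`; namespace `Literature.NumberTheory.Automorphic`.  THEOREMS ONLY (no `def`, no instance, no notation, no axiom, no `sorry`);
generic over real normed spaces `M` (chart ambient) and `E` (values, complete).  Cell `pub/hodgecm-mathlib`, ENGINE T1 (crux H413 =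
`stmt-HodgeConjecture-24833`); FLOOR-2 brick «(J-nc) IN THE RANK-ONE MODEL», FILE C of three (K = `ArchRankOneLimitKernel`, C = this file, M = the `U(1,1)`
model), count-neutral, under ROAD-Sd letter (J-nc) `ArchLimitFormulaNoncompactWall`; LEAD F0P3a-plan (g9) WORD T8-22 (B)(2) ∕ T8-23 (C)(5) ∕ T8-24 (3),
2026-09-01; author B-p17 (g23).  Independent of FILE K (Mathlib only), so that both files stay under the 400-line mark.

THE MATHEMATICS.  FILE K shows that the `ψ`-derivative of the kernel integral tends, as `ψ → 0⁺`, to `∫_{θ}∫_{τ>0} Df(A 0 + τV + τWθ)[A′0 + Wθ]`.  When the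
curve's velocity `A′(0)` IS the line direction `V` (true in the `U(1,1)` model: `A(ψ) = diag(z e^{iψ}, z e^{−iψ})`, `V = iz·diag(1,−1)`), the integrand is the
`τ`-derivative of `τ ↦ f(a + τ(V + Wθ))`, and the integral collapses by the fundamental theorem of calculus on `τ > 0` (compact support kills the term at
`∞`) and the trivial `θ`-integration: **`∫_{Ioi 0 ×ˢ Ioc 0 (2π)} Df(a + τ•V + τ•Wθ)[V + Wθ] = (−(2π)) • f a`** — Harish-Chandra's `(1∕i)F′_{f,B}(1) = −π f(1)` in
these coordinates (the `2π` is the length of the `θ`-circle; print's constant depends on the normalisation of `d(G∕B)`).  Support control in `τ` is phrased, as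
in FILE K, through a functional `ℓ : M →L[ℝ] ℝ` with `ℓ V = 1`, `ℓ (W θ) = 0` and AMBIENT compact support of `f` (WLOG by ★ p840156).

WHAT IS PROVED.  §1 private plumbing (support radius through `ℓ`; integrability on the half-strip and on `Ioi 0` of bounded functions vanishing for `τ ≥ R`);
§2 **(K3)** `integral_fderiv_ray_eq_neg_two_pi_smul`.  HONEST LABEL: HC_CM is proved only modulo the printed citations until rung 0 closes; this is one
step of one rung under ONE letter and pays nothing by itself.

## References
* [Varadarajan1989] V. S. Varadarajan, *An Introduction to Harmonic Analysis on Semisimple Lie Groups*, Cambridge Stud. Adv. Math. 16 (1989), §6.4 Lemma 21 (b)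
  (`U′(0) = −u(0,0)` by integration by parts in the radial variable), Thm 22 (Limit formula).
* [Rogawski1990] J. D. Rogawski, *Automorphic Representations of Unitary Groups in Three Variables*, Ann. of Math. Stud. 123 (1990), §8.2 p. 123.
-/

set_option autoImplicit false

namespace Literature.NumberTheory.Automorphic

open MeasureTheory Set Filter Topology
open scoped Real

variable {M E : Type*} [NormedAddCommGroup M] [NormedSpace ℝ M] [NormedAddCommGroup E] [NormedSpace ℝ E]

/-! ## §1 Plumbing: support radius along rays; integrability on the half-strip and on `Ioi 0` -/

/-- A compactly supported `C¹` map vanishes, together with its derivative, wherever a continuous linear functional is large. [folklore] -/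
private theorem exists_forall_eq_zero_of_lt_abs {f : M → E} (hfc : HasCompactSupport f) (ℓ : M →L[ℝ] ℝ) :
    ∃ R : ℝ, ∀ x, R < |ℓ x| → f x = 0 ∧ fderiv ℝ f x = 0 := by
  obtain ⟨R, hR⟩ := hfc.isCompact.exists_bound_of_continuousOn (f := fun x => ℓ x) ℓ.continuous.continuousOn
  refine ⟨R, fun x hx => ?_⟩
  have hx' : x ∉ tsupport f := fun h => by
    have h1 := hR x h
    simp only [Real.norm_eq_abs] at h1
    linarith
  exact ⟨image_eq_zero_of_notMem_tsupport hx',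
    image_eq_zero_of_notMem_tsupport fun h => hx' (tsupport_fderiv_subset ℝ h)⟩

omit [NormedSpace ℝ E] in
/-- The constant `C` on `{τ ≤ R}` is integrable on the half-strip. [folklore] -/
private theorem integrable_indicator_halfStrip (C R : ℝ) :
    Integrable (indicator (Iic R ×ˢ (univ : Set ℝ)) fun _ : ℝ × ℝ => C)
      (volume.restrict (Ioi (0 : ℝ) ×ˢ Ioc (0 : ℝ) (2 * π))) := by
  refine (integrable_indicator_iff (measurableSet_Iic.prod MeasurableSet.univ)).2 ?_
  rw [IntegrableOn, Measure.restrict_restrict (measurableSet_Iic.prod MeasurableSet.univ)]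
  refine integrableOn_const ?_
  refine ne_of_lt (lt_of_le_of_lt (measure_mono ?_ : _ ≤ volume (Ioc (0 : ℝ) R ×ˢ Ioc (0 : ℝ) (2 * π))) ?_)
  · rintro ⟨a, b⟩ ⟨⟨ha, -⟩, ⟨ha', hb⟩⟩
    exact ⟨⟨ha', ha⟩, hb⟩
  · rw [Measure.volume_eq_prod, Measure.prod_prod, Real.volume_Ioc, Real.volume_Ioc]
    exact ENNReal.mul_lt_top ENNReal.ofReal_lt_top ENNReal.ofReal_lt_top

omit [NormedSpace ℝ E] in
/-- A function on the half-strip that is a.e.-strongly measurable, bounded by `C`, and vanishes for `R ≤ τ` is integrable. [folklore] -/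
private theorem integrable_halfStrip {g : ℝ × ℝ → E} {C R : ℝ}
    (hg : AEStronglyMeasurable g (volume.restrict (Ioi (0 : ℝ) ×ˢ Ioc (0 : ℝ) (2 * π))))
    (hC : ∀ p ∈ Ioi (0 : ℝ) ×ˢ Ioc (0 : ℝ) (2 * π), ‖g p‖ ≤ C)
    (hR : ∀ p ∈ Ioi (0 : ℝ) ×ˢ Ioc (0 : ℝ) (2 * π), R ≤ p.1 → g p = 0) :
    Integrable g (volume.restrict (Ioi (0 : ℝ) ×ˢ Ioc (0 : ℝ) (2 * π))) := by
  refine (integrable_indicator_halfStrip |C| R).mono' hg ?_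
  filter_upwards [ae_restrict_mem (measurableSet_Ioi.prod measurableSet_Ioc)] with p hp
  by_cases h : R ≤ p.1
  · rw [hR p hp h, norm_zero]
    exact indicator_nonneg (fun _ _ => abs_nonneg C) _
  · rw [indicator_of_mem (show p ∈ Iic R ×ˢ (univ : Set ℝ) from ⟨le_of_lt (not_le.1 h), trivial⟩)]
    exact (hC p hp).trans (le_abs_self C)

/-- Uniform vanishing radius along the rays `τ ↦ a + τ•V + μ•W θ`. [folklore] -/
private theorem exists_ray_radius {f : M → E} (hfc : HasCompactSupport f) (a V : M) (W : ℝ → M) (ℓ : M →L[ℝ] ℝ)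
    (hℓV : ℓ V = 1) (hℓW : ∀ θ, ℓ (W θ) = 0) :
    ∃ R : ℝ, ∀ τ μ θ : ℝ, R ≤ τ → f (a + τ • V + μ • W θ) = 0 ∧ fderiv ℝ f (a + τ • V + μ • W θ) = 0 := by
  obtain ⟨Rf, hRf⟩ := exists_forall_eq_zero_of_lt_abs hfc ℓ
  refine ⟨|Rf| + |ℓ a| + 1, fun τ μ θ hτ => hRf _ ?_⟩
  have h : ℓ (a + τ • V + μ • W θ) = ℓ a + τ := by simp [map_add, map_smul, hℓV, hℓW]
  rw [h]
  calc Rf ≤ |Rf| := le_abs_self _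
    _ < ℓ a + τ := by linarith [neg_abs_le (ℓ a)]
    _ ≤ |ℓ a + τ| := le_abs_self _

omit [NormedSpace ℝ E] in
/-- A continuous function on `Ioi 0`, bounded by `C` and vanishing for `R ≤ τ`, is integrable there. [folklore] -/
private theorem integrableOn_Ioi_of_bound {φ : ℝ → E} {C R : ℝ} (hφ : Continuous φ) (hC : ∀ τ, ‖φ τ‖ ≤ C)
    (hR : ∀ τ, R ≤ τ → φ τ = 0) : IntegrableOn φ (Ioi (0 : ℝ)) := by
  have hB : Integrable (indicator (Iic R) fun _ : ℝ => |C|) (volume.restrict (Ioi (0 : ℝ))) := by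
    refine (integrable_indicator_iff measurableSet_Iic).2 ?_
    rw [IntegrableOn, Measure.restrict_restrict measurableSet_Iic]
    refine integrableOn_const (ne_of_lt (lt_of_le_of_lt (measure_mono ?_ : _ ≤ volume (Ioc (0 : ℝ) R)) ?_))
    · rintro a ⟨ha, ha'⟩
      exact ⟨ha', ha⟩
    · rw [Real.volume_Ioc]; exact ENNReal.ofReal_lt_top
  refine hB.mono' hφ.aestronglyMeasurable (Eventually.of_forall fun τ => ?_)
  by_cases h : R ≤ τ
  · rw [hR τ h, norm_zero]
    exact indicator_nonneg (fun _ _ => abs_nonneg C) _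
  · rw [indicator_of_mem (show τ ∈ Iic R from le_of_lt (not_le.1 h))]
    exact (hC τ).trans (le_abs_self C)

/-! ## §2 (K3) The collapse -/

/-- **(K3) Fubini + the fundamental theorem of calculus along the rays `τ ↦ a + τ(V + W θ)`.**  If the limit integrand of (K2) is the `τ`-derivative
of `f` along the ray — which happens exactly when the curve's velocity `A′(0)` equals the line direction `V` — then the limit integral collapses to
the boundary value at `τ = 0`: `∫_{θ ∈ (0,2π]} ∫_{τ>0} ∂_τ f(a + τ(V+Wθ)) dτ dθ = −2π · f(a)`.  This is the computation behind `(1∕i)F′_{f,B}(1) = −π f(1)`.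
[cite: Varadarajan1989, §6.4 Lemma 21 (b), Thm 22] -/
theorem integral_fderiv_ray_eq_neg_two_pi_smul [CompleteSpace E] (f : M → E) (hf : ContDiff ℝ 1 f)
    (hfc : HasCompactSupport f) (a V : M) (W : ℝ → M) (hW : Continuous W) (ℓ : M →L[ℝ] ℝ) (hℓV : ℓ V = 1)
    (hℓW : ∀ θ, ℓ (W θ) = 0) :
    ∫ p in Ioi (0 : ℝ) ×ˢ Ioc (0 : ℝ) (2 * π), fderiv ℝ f (a + p.1 • V + p.1 • W p.2) (V + W p.2) =
      (-(2 * π)) • f a := by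
  obtain ⟨R, hR⟩ := exists_ray_radius hfc a V W ℓ hℓV hℓW
  obtain ⟨Cf, hCf⟩ := (hfc.fderiv ℝ).exists_bound_of_continuous (hf.continuous_fderiv one_ne_zero)
  obtain ⟨CW, hCW⟩ := (isCompact_Icc (a := (0 : ℝ)) (b := 2 * π)).exists_bound_of_continuousOn hW.continuousOn
  have hline : ∀ τ θ : ℝ, a + τ • V + τ • W θ = a + τ • (V + W θ) := fun τ θ => by rw [smul_add, add_assoc]
  have hvan : ∀ τ θ : ℝ, R ≤ τ → fderiv ℝ f (a + τ • (V + W θ)) = 0 := fun τ θ hτ => by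
    rw [← hline]; exact (hR τ τ θ hτ).2
  have hvan0 : ∀ τ θ : ℝ, R ≤ τ → f (a + τ • (V + W θ)) = 0 := fun τ θ hτ => by
    rw [← hline]; exact (hR τ τ θ hτ).1
  -- integrability on the half-strip
  have hcont : Continuous fun p : ℝ × ℝ => fderiv ℝ f (a + p.1 • V + p.1 • W p.2) (V + W p.2) :=
    ((hf.continuous_fderiv one_ne_zero).comp ((continuous_const.add (continuous_fst.smul continuous_const)).add
      (continuous_fst.smul (hW.comp continuous_snd)))).clm_apply (continuous_const.add (hW.comp continuous_snd))
  have hint : Integrable (fun p : ℝ × ℝ => fderiv ℝ f (a + p.1 • V + p.1 • W p.2) (V + W p.2))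
      (volume.restrict (Ioi (0 : ℝ) ×ˢ Ioc (0 : ℝ) (2 * π))) := by
    refine integrable_halfStrip (C := Cf * (‖V‖ + CW)) (R := R) hcont.aestronglyMeasurable (fun p hp => ?_)
      (fun p hp hRp => ?_)
    · calc _ ≤ ‖fderiv ℝ f (a + p.1 • V + p.1 • W p.2)‖ * ‖V + W p.2‖ := ContinuousLinearMap.le_opNorm _ _
        _ ≤ Cf * (‖V‖ + CW) := by
            have hCf' : 0 ≤ Cf := (norm_nonneg _).trans (hCf 0)
            gcongr
            · exact hCf _
            · exact (norm_add_le _ _).trans (add_le_add le_rfl (hCW _ ⟨hp.2.1.le, hp.2.2⟩))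
    · show (fderiv ℝ f _) _ = 0
      rw [hline, hvan p.1 p.2 hRp]
      rfl
  -- Fubini: integrate first in `τ`, then in `θ`
  rw [Measure.volume_eq_prod, ← Measure.prod_restrict] at hint ⊢
  rw [integral_prod_symm _ hint]
  -- the inner integral is `-f a` for every `θ`
  have inner : ∀ θ : ℝ, (∫ τ in Ioi (0 : ℝ), fderiv ℝ f (a + τ • V + τ • W θ) (V + W θ)) = -f a := fun θ => by
    have hderiv : ∀ τ : ℝ, HasDerivAt (fun τ : ℝ => f (a + τ • (V + W θ)))
        (fderiv ℝ f (a + τ • (V + W θ)) (V + W θ)) τ := fun τ => by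
      have h1 : HasDerivAt (fun τ : ℝ => a + τ • (V + W θ)) (V + W θ) τ := by
        simpa using ((hasDerivAt_id τ).smul_const (V + W θ)).const_add a
      exact ((hf.differentiable one_ne_zero) _).hasFDerivAt.comp_hasDerivAt τ h1
    have hφcont : Continuous fun τ : ℝ => f (a + τ • (V + W θ)) :=
      hf.continuous.comp (continuous_const.add (continuous_id.smul continuous_const))
    have hφ'cont : Continuous fun τ : ℝ => fderiv ℝ f (a + τ • (V + W θ)) (V + W θ) :=
      ((hf.continuous_fderiv one_ne_zero).comp (continuous_const.add (continuous_id.smul continuous_const))).clm_apply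
        continuous_const
    have hφ'int : IntegrableOn (fun τ : ℝ => fderiv ℝ f (a + τ • (V + W θ)) (V + W θ)) (Ioi (0 : ℝ)) :=
      integrableOn_Ioi_of_bound (C := Cf * ‖V + W θ‖) hφ'cont
        (fun τ => (ContinuousLinearMap.le_opNorm _ _).trans (by gcongr; exact hCf _))
        (fun τ hτ => by show (fderiv ℝ f _) _ = 0; rw [hvan τ θ hτ]; rfl)
    have hlim : Tendsto (fun τ : ℝ => f (a + τ • (V + W θ))) atTop (𝓝 0) :=
      tendsto_const_nhds.congr' ((eventually_ge_atTop R).mono fun τ hτ => (hvan0 τ θ hτ).symm)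
    have key := integral_Ioi_of_hasDerivAt_of_tendsto hφcont.continuousWithinAt (fun τ _ => hderiv τ) hφ'int hlim
    simp only [zero_smul, add_zero, zero_sub] at key
    rw [← key]
    refine setIntegral_congr_fun measurableSet_Ioi fun τ _ => ?_
    rw [hline]
  simp_rw [inner]
  rw [setIntegral_const, Real.volume_real_Ioc_of_le (by positivity), sub_zero, smul_neg, neg_smul]

end Literature.NumberTheory.Automorphic
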